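import Mathlib.Analysis.Distribution.TemperedDistribution
import Mathlib.Analysis.Calculus.LineDeriv.IntegrationByParts
import Mathlib.Analysis.InnerProductSpace.Laplacian
import HarnessLib

/-!
# Distributional and classical derivatives agree for `C¹_b` / `C²_b` functions (Schauder program, item A′3)

Topic `Literature/Analysis/FunctionSpaces`. For a function `u : E → F` of class `C¹` on a
finite-dimensional real inner product space, bounded with bounded derivative, the directional
derivative `∂_m` of the tempered distribution `[u] ∈ 𝓢'(E, F)` defined by the `L^∞` function `u`
(Mathlib's `MeasureTheory.Lp.toTemperedDistribution`) is the tempered distribution of the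
classical derivative `x ↦ Du(x) m` — integration by parts against Schwartz functions
(`integral_smul_fderiv_eq_neg_fderiv_smul_of_integrable`). Iterating, for `u` of class `C²`
with bounded derivatives up to order `2` the distributional Laplacian `Δ [u]` is `[Δ u]`.

* `lineDerivOp_coe_toLp_eq` — `∂_m [u] = [x ↦ Du(x) m]`;
* `integral_schwartz_smul_fderiv_eq` — the integration by parts;
* `laplacian_coe_toLp_eq` — `Δ [u] = [Δ u]`.

This identification lets the Littlewood–Paley elliptic block estimate
(`LittlewoodPaleyEllipticBlock.lean`) be applied to classical `C^{2,α}_b` functions (constant-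
coefficient Schauder estimate, census item (2a) of
`Literature.Geometry.Riemannian.gurskyViaclovsky_pathOpen_weighted_four`). Everything is proved;
no named facts.

## References

* L. Hörmander, *The Analysis of Linear Partial Differential Operators I* (1990), §3.1
  (distribution derivatives of `C¹` functions). [folklore]
* D. Gilbarg, N. S. Trudinger, *Elliptic Partial Differential Equations of Second Order* (2001),
  §7.3 (weak derivatives). [GilbargTrudinger2001]
-/

noncomputable section

open MeasureTheory SchwartzMap Filter Topology Function
open scoped SchwartzMap ENNReal NNReal ContDiff LineDeriv Laplacian

namespace Literature.Analysis.FunctionSpaces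

open TemperedDistribution

variable {E : Type*} [NormedAddCommGroup E] [InnerProductSpace ℝ E] [FiniteDimensional ℝ E]
  [MeasurableSpace E] [BorelSpace E] {F : Type*} [NormedAddCommGroup F] [NormedSpace ℂ F]
  [CompleteSpace F]

/-- **`∂_m [u] = [Du · m]` for `u ∈ C¹_b`.** If `u : E → F` is `C¹` and `u`, `x ↦ Du(x) m` are
(essentially) bounded, then the distributional directional derivative of the tempered
distribution of `u` is the tempered distribution of the classical directional derivative.
[cite: GilbargTrudinger2001, §7.3] -/
theorem lineDerivOp_coe_toLp_eq {u : E → F} (hu : ContDiff ℝ 1 u) (m : E)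
    (h₁ : MemLp u ∞ (volume : Measure E))
    (h₂ : MemLp (fun x => fderiv ℝ u x m) ∞ (volume : Measure E)) :
    ∂_{m} ((h₁.toLp u : Lp F ∞ (volume : Measure E)) : 𝓢'(E, F)) =
      ((h₂.toLp _ : Lp F ∞ (volume : Measure E)) : 𝓢'(E, F)) := by
  ext φ
  rw [lineDerivOp_apply_apply, Lp.toTemperedDistribution_apply, Lp.toTemperedDistribution_apply]
  -- replace the `Lp` representatives by the functions
  have hI1 : ∫ x, (-∂_{m} φ) x • (h₁.toLp u : Lp F ∞ (volume : Measure E)) x =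
      ∫ x, (-∂_{m} φ) x • u x := by
    refine integral_congr_ae ?_
    filter_upwards [h₁.coeFn_toLp] with x hx
    rw [hx]
  have hI2 : ∫ x, φ x • (h₂.toLp _ : Lp F ∞ (volume : Measure E)) x =
      ∫ x, φ x • fderiv ℝ u x m := by
    refine integral_congr_ae ?_
    filter_upwards [h₂.coeFn_toLp] with x hx
    rw [hx]
  rw [hI1, hI2]
  -- `(-∂_m φ) x = - fderiv φ x m`
  have hφ' : ∀ x, (-∂_{m} φ) x = -(fderiv ℝ (φ : E → ℂ) x m) := fun x => by
    rw [neg_apply, SchwartzMap.lineDerivOp_apply, φ.differentiableAt.lineDeriv_eq_fderiv]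
  simp_rw [hφ', neg_smul, integral_neg]
  -- integration by parts
  have hdφ : Integrable (fun x => fderiv ℝ (φ : E → ℂ) x m) (volume : Measure E) := by
    have h := (∂_{m} φ).integrable (μ := (volume : Measure E))
    refine h.congr (Eventually.of_forall fun x => ?_)
    rw [SchwartzMap.lineDerivOp_apply, φ.differentiableAt.lineDeriv_eq_fderiv]
  have hf'g : Integrable (fun x => fderiv ℝ (φ : E → ℂ) x m • u x) (volume : Measure E) :=
    hdφ.smul_of_top_left h₁
  have hfg' : Integrable (fun x => (φ : E → ℂ) x • fderiv ℝ u x m) (volume : Measure E) :=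
    (φ.integrable).smul_of_top_left h₂
  have hfg : Integrable (fun x => (φ : E → ℂ) x • u x) (volume : Measure E) :=
    (φ.integrable).smul_of_top_left h₁
  have hud : Differentiable ℝ u := hu.differentiable one_ne_zero
  rw [integral_smul_fderiv_eq_neg_fderiv_smul_of_integrable hf'g hfg' hfg
    (fun x _ => φ.differentiableAt) (fun x _ => hud x)]

omit [CompleteSpace F] in
/-- **Integration by parts against a Schwartz function**: for `u ∈ C¹_b` and `φ ∈ 𝓢(E, ℂ)`,
`∫ φ • (Du · m) = -∫ (Dφ · m) • u`. [cite: GilbargTrudinger2001, §7.3] -/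
theorem integral_schwartz_smul_fderiv_eq {u : E → F} (hu : ContDiff ℝ 1 u) (m : E)
    (h₁ : MemLp u ∞ (volume : Measure E))
    (h₂ : MemLp (fun x => fderiv ℝ u x m) ∞ (volume : Measure E)) (φ : 𝓢(E, ℂ)) :
    ∫ x, (φ : E → ℂ) x • fderiv ℝ u x m = -∫ x, fderiv ℝ (φ : E → ℂ) x m • u x := by
  have hdφ : Integrable (fun x => fderiv ℝ (φ : E → ℂ) x m) (volume : Measure E) := by
    have h := (∂_{m} φ).integrable (μ := (volume : Measure E))
    refine h.congr (Eventually.of_forall fun x => ?_)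
    rw [SchwartzMap.lineDerivOp_apply, φ.differentiableAt.lineDeriv_eq_fderiv]
  have hud : Differentiable ℝ u := hu.differentiable one_ne_zero
  exact integral_smul_fderiv_eq_neg_fderiv_smul_of_integrable (hdφ.smul_of_top_left h₁)
    ((φ.integrable).smul_of_top_left h₂) ((φ.integrable).smul_of_top_left h₁)
    (fun x _ => φ.differentiableAt) (fun x _ => hud x)

omit [FiniteDimensional ℝ E] [MeasurableSpace E] [BorelSpace E] [CompleteSpace F] in
/-- The second directional derivative as an iterated derivative:
`D(x ↦ Du(x) m)(x) m = D²u(x)(m, m)`. [folklore] -/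
theorem fderiv_fderiv_apply_eq_iteratedFDeriv_two {u : E → F} (hu : ContDiff ℝ 2 u) (m x : E) :
    fderiv ℝ (fun y => fderiv ℝ u y m) x m = iteratedFDeriv ℝ 2 u x ![m, m] := by
  have hd : DifferentiableAt ℝ (fderiv ℝ u) x :=
    ((hu.fderiv_right (m := 1) (by norm_num)).differentiable one_ne_zero x)
  rw [fderiv_clm_apply hd (differentiableAt_const m), iteratedFDeriv_two_apply]
  simp

/-- **`Δ [u] = [Δ u]` for `u ∈ C²_b`.** If `u : E → F` is `C²` with `u`, its first directional
derivatives and its pure second directional derivatives (essentially) bounded, then the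
distributional Laplacian of the tempered distribution of `u` is the tempered distribution of the
classical Laplacian `Δ u = ∑ᵢ D²u(eᵢ, eᵢ)`. [cite: GilbargTrudinger2001, §7.3] -/
theorem laplacian_coe_toLp_eq {u : E → F} (hu : ContDiff ℝ 2 u)
    (h₀ : MemLp u ∞ (volume : Measure E))
    (h₁ : ∀ m : E, MemLp (fun x => fderiv ℝ u x m) ∞ (volume : Measure E))
    (h₂ : ∀ m : E, MemLp (fun x => fderiv ℝ (fun y => fderiv ℝ u y m) x m) ∞ (volume : Measure E))
    (hΔ : MemLp (Δ u) ∞ (volume : Measure E)) :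
    Δ ((h₀.toLp u : Lp F ∞ (volume : Measure E)) : 𝓢'(E, F)) =
      ((hΔ.toLp _ : Lp F ∞ (volume : Measure E)) : 𝓢'(E, F)) := by
  set b := stdOrthonormalBasis ℝ E with hb
  ext φ
  rw [laplacian_apply_apply, Lp.toTemperedDistribution_apply, Lp.toTemperedDistribution_apply]
  have hI1 : ∫ x, (Δ φ) x • (h₀.toLp u : Lp F ∞ (volume : Measure E)) x = ∫ x, (Δ φ) x • u x := by
    refine integral_congr_ae ?_
    filter_upwards [h₀.coeFn_toLp] with x hx
    rw [hx]
  have hI2 : ∫ x, φ x • (hΔ.toLp _ : Lp F ∞ (volume : Measure E)) x = ∫ x, φ x • (Δ u) x := by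
    refine integral_congr_ae ?_
    filter_upwards [hΔ.coeFn_toLp] with x hx
    rw [hx]
  rw [hI1, hI2]
  -- expand both Laplacians in the orthonormal basis `b`
  have hφΔ : ∀ x, (Δ φ) x = ∑ i, fderiv ℝ (fun y => fderiv ℝ (φ : E → ℂ) y (b i)) x (b i) := by
    intro x
    rw [SchwartzMap.laplacian_eq_sum b φ, sum_apply]
    refine Finset.sum_congr rfl fun i _ => ?_
    rw [SchwartzMap.lineDerivOp_apply,
      (SchwartzMap.differentiableAt (∂_{b i} φ)).lineDeriv_eq_fderiv]
    congr 1
  have huΔ : ∀ x, (Δ u) x = ∑ i, fderiv ℝ (fun y => fderiv ℝ u y (b i)) x (b i) := by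
    intro x
    rw [InnerProductSpace.laplacian_eq_iteratedFDeriv_orthonormalBasis u b]
    exact Finset.sum_congr rfl fun i _ => (fderiv_fderiv_apply_eq_iteratedFDeriv_two hu _ _).symm
  simp_rw [hφΔ, huΔ, Finset.sum_smul, Finset.smul_sum]
  -- the first derivatives `uᵢ = Du · eᵢ` are `C¹_b`
  have hu1 : ContDiff ℝ 1 u := hu.of_le (by norm_num)
  have hui : ∀ i, ContDiff ℝ 1 fun y => fderiv ℝ u y (b i) := fun i =>
    (hu.fderiv_right (m := 1) (by norm_num)).clm_apply contDiff_const
  -- the Schwartz first derivatives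
  have hφi : ∀ i, (fun y => fderiv ℝ (φ : E → ℂ) y (b i)) = ((∂_{b i} φ : 𝓢(E, ℂ)) : E → ℂ) := by
    intro i
    funext y
    rw [SchwartzMap.lineDerivOp_apply, φ.differentiableAt.lineDeriv_eq_fderiv]
  -- integrability of all summands
  have hint1 : ∀ i, Integrable (fun x => fderiv ℝ (fun y => fderiv ℝ (φ : E → ℂ) y (b i)) x (b i) • u x)
      (volume : Measure E) := by
    intro i
    rw [hφi i]
    have hd : Integrable (fun x => fderiv ℝ ((∂_{b i} φ : 𝓢(E, ℂ)) : E → ℂ) x (b i)) (volume : Measure E) := by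
      have h := (∂_{b i} (∂_{b i} φ)).integrable (μ := (volume : Measure E))
      refine h.congr (Eventually.of_forall fun x => ?_)
      rw [SchwartzMap.lineDerivOp_apply,
        (SchwartzMap.differentiableAt (∂_{b i} φ)).lineDeriv_eq_fderiv]
    exact hd.smul_of_top_left h₀
  have hint2 : ∀ i, Integrable (fun x => (φ : E → ℂ) x • fderiv ℝ (fun y => fderiv ℝ u y (b i)) x (b i))
      (volume : Measure E) := fun i => (φ.integrable).smul_of_top_left (h₂ (b i))
  rw [integral_finsetSum _ fun i _ => hint1 i, integral_finsetSum _ fun i _ => hint2 i]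
  refine Finset.sum_congr rfl fun i _ => ?_
  -- integrate by parts twice
  have hA := integral_schwartz_smul_fderiv_eq hu1 (b i) h₀ (h₁ (b i)) (∂_{b i} φ)
  have hB := integral_schwartz_smul_fderiv_eq (hui i) (b i) (h₁ (b i)) (h₂ (b i)) φ
  have hC : ∫ x, fderiv ℝ ((∂_{b i} φ : 𝓢(E, ℂ)) : E → ℂ) x (b i) • u x =
      -∫ x, ((∂_{b i} φ : 𝓢(E, ℂ)) : E → ℂ) x • fderiv ℝ u x (b i) := by
    rw [hA, neg_neg]
  have hpt : ∀ x, ((∂_{b i} φ : 𝓢(E, ℂ)) : E → ℂ) x = fderiv ℝ (φ : E → ℂ) x (b i) := fun x =>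
    (congrFun (hφi i) x).symm
  rw [hB, hφi i, hC]
  simp_rw [hpt]

end Literature.Analysis.FunctionSpaces

end
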